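import Literature.AlgebraicGeometry.Modules.CechCup
import HarnessLib

/-!
# Venture HSemireg — route R1.0, rows `q ≥ 2`: anticommuting Čech `1`-cocycles have commuting cup classes
# (th-4; the cup-one homotopy behind (L5) "centrality" of `general-structure/LEIBNIZ-ROW2-PLAN-gs-g4.md`)

HONEST FRAMING. An abstract identity of Čech cochains of local homomorphisms between `𝒪_Y`-modules on a scheme
`Y` (`Modules/CechCup`: `LocalFamily`, `cupFamily`, `dFamily`, `classOf`, `classOf_cupFamily`). Nothing about any
variety; nothing here says HC, HC_CM or HC_AV is proved.

WHAT IS PROVED (`namespace Summit.Ventures.HSemireg.Cech`). For `1`-cochains `a : A → B`, `s' : B → C`, `s : A → B'`,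
`a' : B' → C` on one cover `U`:

* `cupFamily_eq_add_dFamily_of_anticomm` — if `a`, `s'` are cocycles and the pairs ANTICOMMUTE on every triangle,
  `a'_{yz}(s_{xy} x) = -s'_{xy}(a_{yz} x)` (note the index pattern), then `s ∪ a' = a ∪ s' + d(a ∪₁ s')` with the
  **cup-one product** `(a ∪₁ s')_{xy} = a_{xy} ≫ s'_{xy}` (written inline as `fun β => a β ≫ s' β`)
  (expand `d(a ∪₁ s')_{xyz} = s'_{yz}a_{yz} - s'_{xz}a_{xz} + s'_{xy}a_{xy}` with `a_{xz} = a_{xy} + a_{yz}`,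
  `s'_{xz} = s'_{xy} + s'_{yz}`: Godement's homotopy for the graded commutativity of the cup product, in the
  non-commutative-coefficient form the Atiyah steps need);
* `classOf_cupFamily_eq_of_anticomm`, `comp_classOf_eq_of_anticomm` — hence `[s ∪ a'] = [a ∪ s']` and, by
  `classOf_cupFamily`, the Yoneda composites agree: **`[s] · [a'] = [a] · [s']` in `Ext²(A, C)`** (Mathlib `Ext.comp`
  order).

Used by `UntwistAtiyahStepCommute` with `a`, `a'` the level-`j`, `(j+1)` Atiyah cocycles and `s`, `s'` the wedge
families `φ ↦ φ ≫ (θ_{xy} ∧ –)`.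

## References

* R. Godement, *Topologie algébrique et théorie des faisceaux* (1958), II.6 (cup products of Čech cochains and their
  commutativity up to homotopy).
* R. Hartshorne, *Algebraic Geometry* (1977), III.4 (Čech cohomology). [Hartshorne1977]
-/

set_option backward.isDefEq.respectTransparency false

noncomputable section

universe u

open CategoryTheory CategoryTheory.Abelian AlgebraicGeometry Opposite TopologicalSpace Limits

/-! ### Anticommuting `1`-cocycles have commuting cup classes -/

namespace Summit.Ventures.HSemireg

namespace Cech

open Literature.AlgebraicGeometry.Modules Literature.AlgebraicGeometry.Modules.Cech

variable {Y : Scheme.{u}} {ι : Type u} {U : ι → Y.Opens} {A B B' C : Y.Modules}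
  (a : LocalFamily U 1 A B) (s' : LocalFamily U 1 B C) (s : LocalFamily U 1 A B') (a' : LocalFamily U 1 B' C)

/-- `back 1 τ = (τ 1, τ 2) = τ ∘ δ₀` for a triangle `τ`. [folklore] -/
lemma back_one_eq_comp_succAbove_zero (τ : Fin 3 → ι) : back 1 τ = τ ∘ Fin.succAbove 0 := by
  funext j
  change τ (Fin.natAdd 1 j) = τ (Fin.succAbove 0 j)
  congr 1
  rw [Fin.succAbove_zero]
  ext
  simp only [Fin.val_natAdd, Fin.val_succ]
  omega

/-- `front τ = (τ 0, τ 1) = τ ∘ δ₂` for a triangle `τ`. [folklore] -/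
lemma front_eq_comp_succAbove_two (τ : Fin 3 → ι) : front τ = τ ∘ Fin.succAbove 2 := by
  change τ ∘ Fin.castSucc = τ ∘ Fin.succAbove (Fin.last 2)
  rw [Fin.succAbove_last]

/-- **Anticommuting cocycles**: `s ∪ a' = a ∪ s' + d(a ∪₁ s')` whenever `a'_{yz} ∘ s_{xy} = -s'_{xy} ∘ a_{yz}` on
every triangle and `a`, `s'` are cocycles (Godement's cup-one homotopy for the graded commutativity of the cup
product, in the form the Atiyah steps need). [folklore] -/
theorem cupFamily_eq_add_dFamily_of_anticomm (ha : dFamily a = 0) (hs' : dFamily s' = 0)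
    (H : ∀ (τ : Fin 3 → ι) {W : Y.Opens} (k : W ⟶ face U τ) (x : Γ(A, W)),
      appLE (a' (back 1 τ)) (k ≫ homOfLE (face_le_face_back U 1 τ))
          (appLE (s (front τ)) (k ≫ homOfLE (face_le_face_front U τ)) x) =
        -appLE (s' (front τ)) (k ≫ homOfLE (face_le_face_front U τ))
          (appLE (a (back 1 τ)) (k ≫ homOfLE (face_le_face_back U 1 τ)) x)) :
    cupFamily a' s = cupFamily s' a + dFamily (fun β => a β ≫ s' β : LocalFamily U 1 A C) := by
  funext τ
  refine hom_ext_of_appLE fun W k x => ?_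
  rw [appLE_cupFamily, H τ k x]
  change _ = appLE (cupFamily s' a τ + dFamily (fun β => a β ≫ s' β : LocalFamily U 1 A C) τ) k x
  rw [appLE_add, appLE_cupFamily, dFamily, appLE_sum, Fin.sum_univ_three, appLE_zsmul, appLE_zsmul,
    appLE_zsmul, appLE_restrictHom, appLE_restrictHom, appLE_restrictHom]
  simp only [Fin.val_zero, pow_zero, one_smul, Fin.val_one, pow_one, neg_one_zsmul, Fin.val_two, neg_one_sq,
    appLE_comp]
  -- names for the inclusions of `W` into the three edges
  set k₀ := k ≫ homOfLE (face_le_face_comp U τ (Fin.succAbove 0))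
  set k₁ := k ≫ homOfLE (face_le_face_comp U τ (Fin.succAbove 1))
  set k₂ := k ≫ homOfLE (face_le_face_comp U τ (Fin.succAbove 2))
  -- move the `front`/`back` values to the `δ₂`/`δ₀` edges
  rw [appLE_family_congr a (front_eq_comp_succAbove_two τ) _ k₂,
    appLE_family_congr s' (back_one_eq_comp_succAbove_zero τ) _ k₀,
    appLE_family_congr a (back_one_eq_comp_succAbove_zero τ) _ k₀,
    appLE_family_congr s' (front_eq_comp_succAbove_two τ) _ k₂]
  -- the two cocycle identities
  have hca : appLE (a (τ ∘ Fin.succAbove 1)) k₁ x =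
      appLE (a (τ ∘ Fin.succAbove 0)) k₀ x + appLE (a (τ ∘ Fin.succAbove 2)) k₂ x := by
    have h := cocycle_apply a ha τ k k₀ k₁ k₂ x
    rw [sub_add_eq_add_sub, sub_eq_zero] at h
    exact h.symm
  have hcs : ∀ y : Γ(B, W), appLE (s' (τ ∘ Fin.succAbove 1)) k₁ y =
      appLE (s' (τ ∘ Fin.succAbove 0)) k₀ y + appLE (s' (τ ∘ Fin.succAbove 2)) k₂ y := fun y => by
    have h := cocycle_apply s' hs' τ k k₀ k₁ k₂ y
    rw [sub_add_eq_add_sub, sub_eq_zero] at h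
    exact h.symm
  rw [hca, hcs, appLE_add_right, appLE_add_right]
  abel

variable [HasExt.{u + 1} Y.Modules]

/-- Hence **the cup classes agree**: `[s ∪ a'] = [a ∪ s']`. [folklore] -/
theorem classOf_cupFamily_eq_of_anticomm (c : Literature.Algebra.Homology.ExactAugmentation (complex U C) C)
    (ha : dFamily a = 0) (hs' : dFamily s' = 0) (hs : dFamily s = 0) (ha' : dFamily a' = 0)
    (H : ∀ (τ : Fin 3 → ι) {W : Y.Opens} (k : W ⟶ face U τ) (x : Γ(A, W)),
      appLE (a' (back 1 τ)) (k ≫ homOfLE (face_le_face_back U 1 τ))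
          (appLE (s (front τ)) (k ≫ homOfLE (face_le_face_front U τ)) x) =
        -appLE (s' (front τ)) (k ≫ homOfLE (face_le_face_front U τ))
          (appLE (a (back 1 τ)) (k ≫ homOfLE (face_le_face_back U 1 τ)) x)) :
    classOf c (cupFamily a' s) (dFamily_cupFamily a' ha' s hs) =
      classOf c (cupFamily s' a) (dFamily_cupFamily s' hs' a ha) :=
  classOf_eq_of_eq_add_dFamily c (fun β => a β ≫ s' β) _ _ (cupFamily_eq_add_dFamily_of_anticomm a s' s a' ha hs' H)

/-- **Anticommuting cocycles have commuting Yoneda composites**: `[s] · [a'] = [a] · [s']` in `Ext²(A, C)`.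
[folklore] -/
theorem comp_classOf_eq_of_anticomm
    (b : Literature.Algebra.Homology.ExactAugmentation (complex U B) B)
    (b' : Literature.Algebra.Homology.ExactAugmentation (complex U B') B')
    (c : Literature.Algebra.Homology.ExactAugmentation (complex U C) C)
    (hb : b.ε = augment U B) (hb' : b'.ε = augment U B')
    (ha : dFamily a = 0) (hs' : dFamily s' = 0) (hs : dFamily s = 0) (ha' : dFamily a' = 0)
    (H : ∀ (τ : Fin 3 → ι) {W : Y.Opens} (k : W ⟶ face U τ) (x : Γ(A, W)),
      appLE (a' (back 1 τ)) (k ≫ homOfLE (face_le_face_back U 1 τ))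
          (appLE (s (front τ)) (k ≫ homOfLE (face_le_face_front U τ)) x) =
        -appLE (s' (front τ)) (k ≫ homOfLE (face_le_face_front U τ))
          (appLE (a (back 1 τ)) (k ≫ homOfLE (face_le_face_back U 1 τ)) x)) :
    (classOf b' s hs).comp (classOf c a' ha') rfl = (classOf b a ha).comp (classOf c s' hs') rfl := by
  rw [← classOf_cupFamily a' b' c hb' ha' s hs, ← classOf_cupFamily s' b c hb hs' a ha]
  exact classOf_cupFamily_eq_of_anticomm a s' s a' c ha hs' hs ha' H

end Cech

end Summit.Ventures.HSemireg

end
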